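import Mathlib
import HarnessLib
import Summits.HubbardSuperconductivity.HubbardSuperconductivity.Theorems.KLProgrammeKLRegimeSplitTwoLegMomentsFromGrid
import Summits.HubbardSuperconductivity.HubbardSuperconductivity.Theorems.KLProgrammeKLRegimeTwoVolumeSymInterp

/-!
# Route `KLProgramme` — ENGINE child `KLRegimeEngineV16` (stmt-HubbardSuperconductivity-20236), `stub_twoLeg_scale0`, conjunct
# (E3f-AT)₀, spatial nested leg `hsp`: the GRID READ-OUT — the interpolant's two-volume difference is the pinned two-leg GRID-kernel
# defect at ONE block-centre pin (cell gate-hubbard-kl, seat hubbard-kl-k3c5-p2 g6, β′ lane, step (m5)-b of HOME/…/BETA-PRIME-ROADMAP.md)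

Sequel of `…TwoVolumeSymInterp` ((m5)-a: `|(symInterp L f).eval q − (symInterp L″ g).eval q| ≤ PINNED coefficient difference + fine
FAR tail`) and of p1b's Fourier bridge from a GRID representation `G = map S W`, `S = gridSubMatrix L M β x τ`
([tree] `TwoLegFourier.sum_selfEnergy_map_gridSub_mul_torusChar`:
`Σ_{k⃗} Σ_G((ω,k⃗),σ)·χ_{k⃗}(y) = (2/β)·Σ_{p : x_{p₀} − x_{p₁} + y = 0} e^{iω(τ_{p₀} − τ_{p₁})}·kernel W 2 ((p₀,σ,+),(p₁,σ,−))`).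

* §1 even complex data: `c(y) = L⁻²·Re Σ_{k⃗} F(k⃗) χ_{k⃗}(y)`; the EXACT one-volume identity **`torusCosCoeff_re_selfEnergy_map_gridSub_eq`**;
* §2 pair sum = sum of phase-weighted ROWS `R_W(p₀, y) := Σ_{p₁ : x_{p₁} = x_{p₀} + y} e^{iω(τ_{p₀} − τ_{p₁})}·W(p₀,p₁)` (`sum_pair_eq_sum_row`);
  base-point–independent rows (`hrow`, the twisted translation invariance of the grid action) and `|P| = N·L²` give
  **`torusCosCoeff_re_selfEnergy_eq_row`**: `c(y) = (2N/β)·Re R_W(o, y)` — the SAME prefactor `2N/β` at every volume on the common time grid;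
* §3 TWO NESTED VOLUMES `Lf = b·Lc`, grids `P`, `P'` with an embedding `ι : P → P'` onto the CENTRED BLOCK (`x'(ι p) = clift (x p)`,
  `τ'(ι p) = τ p`, every fine point with centred-lift site is in the range), base point at the origin: **`pinned_add_far_le_gridDefect`**
  `Σ_{x̄} |c(x̄) − c'(clift x̄)| + Σ_{y ≠ clift(red y)} |c'(y)| ≤ (2N/|β|)·[Σ_{p₁} ‖W(o,p₁) − W'(ι o, ι p₁)‖ + Σ_{p₁' ∉ range ι} ‖W'(ι o, p₁')‖]`
  — the PINNED TWO-LEG DEFECT at the block-centre pin between the fine kernel and the block-embedded coarse kernel, i.e. what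
  `sum_norm_kernel_twoVolumeDefect_le` (p515439) bounds once the decoupled action is the block copies (k3c4-p1's `GrassmannEffectiveActionCopies`);
* the composition with (m5)-a (interpolant VALUES) is the sequel `…TwoVolumeGridReadoutEval`.

Proofs only; no definitions (rows, lifts, reductions inline); the grids, substitutions and kernels are arbitrary (hypotheses
`hrow`/`heven` are discharged at the model by the engine lane); nothing is asserted about the model.
References: BGM 2006 §2.1 (2.5), §2.3 (2.17) [`BenfattoGiulianiMastropietro2006`]; Friedli–Velenik 2017 §10.4 (Poisson on nested tori).
-/

noncomputable section

namespace Summit.HubbardSuperconductivity.HubbardSuperconductivity.Theorems.TwoVolumeDefect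

set_option linter.dupNamespace false -- summit = problem name (single-conjunct summit), D-0017

open Finset Complex Literature.MathematicalPhysics.QuantumLattice Literature.Probability.LatticeModels GrassmannAlgebra
open Summit.HubbardSuperconductivity.HubbardSuperconductivity.Theorems.KLRegimeSplit
open Summit.HubbardSuperconductivity.HubbardSuperconductivity.Theorems.TwoPointAssembly
open Summit.HubbardSuperconductivity.HubbardSuperconductivity.Theorems.TwoLegFourier
open scoped ComplexConjugate

/-! ## §1 Even data: the cosine coefficient is the real part of the character sum; the exact one-volume grid identity -/

section OneVolume

variable {L M : ℕ} [NeZero L] {P : Type*} [Fintype P] [DecidableEq P]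

omit [DecidableEq P] [Fintype P] in
/-- For `k⃗`-EVEN complex data `F`, `Σ_k Re F(k)·cos(p_k·ỹ) = Re Σ_k F(k) χ_k(y)` (the `Im F·Im χ` cross terms cancel in pairs `k ↔ −k`). -/
theorem sum_re_mul_cos_eq_re_sum_mul_torusChar_of_even (F : TorusSite 2 L → ℂ) (heven : ∀ k, F (-k) = F k) (y : TorusSite 2 L) :
    ∑ k : TorusSite 2 L, (F k).re * Real.cos (∑ i : Fin 2, latticeMomentum L k i * ((y i).valMinAbs : ℝ)) =
      (∑ k : TorusSite 2 L, F k * torusChar k y).re := by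
  simp_rw [cos_latticeMomentum_valMinAbs_eq_re]
  rw [Complex.re_sum]
  have him : ∑ k : TorusSite 2 L, (F k).im * (torusChar k y).im = 0 := by
    have hneg : ∑ k : TorusSite 2 L, (F k).im * (torusChar k y).im =
        ∑ k : TorusSite 2 L, (F (-k)).im * (torusChar (-k) y).im :=
      (Fintype.sum_equiv (Equiv.neg (TorusSite 2 L)) _ _ fun k => rfl).symm
    have hterm : ∀ k : TorusSite 2 L, (F (-k)).im * (torusChar (-k) y).im = -((F k).im * (torusChar k y).im) := by
      intro k
      rw [heven k, ← torusChar_neg_right_eq_neg_left, torusChar_neg_right, Complex.conj_im]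
      ring
    simp_rw [hterm, Finset.sum_neg_distrib] at hneg
    linarith
  have hk : ∀ k : TorusSite 2 L, (F k * torusChar k y).re = (F k).re * (torusChar k y).re - (F k).im * (torusChar k y).im :=
    fun k => Complex.mul_re _ _
  simp_rw [hk, Finset.sum_sub_distrib, him, sub_zero]

omit [DecidableEq P] [Fintype P] in
/-- For even data the cosine coefficient is `L⁻²·Re Σ_k F(k) χ_k(y)`. -/
theorem torusCosCoeff_re_eq_of_even (F : TorusSite 2 L → ℂ) (heven : ∀ k, F (-k) = F k) (y : TorusSite 2 L) :
    torusCosCoeff L (fun k => (F k).re) y = ((L : ℝ) ^ 2)⁻¹ * (∑ k : TorusSite 2 L, F k * torusChar k y).re := by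
  unfold torusCosCoeff
  rw [sum_re_mul_cos_eq_re_sum_mul_torusChar_of_even F heven y]

/-- **The EXACT one-volume grid identity for the cosine coefficients of `k⃗ ↦ Re Σ_G((ω,k⃗),σ)`, `G = map S W`, even data**:
`c(y) = (2/(βL²))·Re Σ_{p : x_{p₀} − x_{p₁} + y = 0} e^{iω(τ_{p₀} − τ_{p₁})}·kernel W 2 ((p₀,σ,+),(p₁,σ,−))`. -/
theorem torusCosCoeff_re_selfEnergy_map_gridSub_eq [NeZero M] {β : ℝ} (hβ : β ≠ 0) (x : P → TorusSite 2 L) (τ : P → ℝ)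
    (W : GrassmannAlgebra ℂ (GridLeg P)) (n : MatsubaraIdx M) (σ : Fin 2)
    (heven : ∀ k : TorusSite 2 L,
      selfEnergy L M β (ExteriorAlgebra.map (Matrix.toLin' (gridSubMatrix L M β x τ)) W) (n, -k) σ =
        selfEnergy L M β (ExteriorAlgebra.map (Matrix.toLin' (gridSubMatrix L M β x τ)) W) (n, k) σ)
    (y : TorusSite 2 L) :
    torusCosCoeff L (fun k => (selfEnergy L M β (ExteriorAlgebra.map (Matrix.toLin' (gridSubMatrix L M β x τ)) W) (n, k) σ).re) y =
      2 / (β * (L : ℝ) ^ 2) * (∑ p : Fin 2 → P, if x (p 0) - x (p 1) + y = 0 then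
        Complex.exp (((matsubaraFreq β M n * (τ (p 0) - τ (p 1)) : ℝ) : ℂ) * Complex.I) * kernel ℂ W 2 (fun i => ((p i, σ), i))
        else 0).re := by
  rw [torusCosCoeff_re_eq_of_even _ heven, sum_selfEnergy_map_gridSub_mul_torusChar hβ, Complex.re_ofReal_mul]
  ring

end OneVolume

/-! ## §2 The double grid sum as a sum of phase-weighted rows; base-point independence removes the volume factor -/

section Rows

variable {L M : ℕ} [NeZero L] {P : Type*} [Fintype P] [DecidableEq P]

omit [NeZero L] [DecidableEq P] in
/-- The pair sum of p1b's identity as a sum over the first point of ROWS: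
`Σ_{p : x_{p₀} − x_{p₁} + y = 0} Φ p = Σ_{p₀} Σ_{p₁ : x_{p₁} = x_{p₀} + y} Φ ![p₀, p₁]`. -/
theorem sum_pair_eq_sum_row (x : P → TorusSite 2 L) (Φ : (Fin 2 → P) → ℂ) (y : TorusSite 2 L) :
    (∑ p : Fin 2 → P, if x (p 0) - x (p 1) + y = 0 then Φ p else 0) =
      ∑ p₀ : P, ∑ p₁ : P, if x p₁ = x p₀ + y then Φ ![p₀, p₁] else 0 := by
  rw [← Fintype.sum_prod_type' (f := fun p₀ p₁ => if x p₁ = x p₀ + y then Φ ![p₀, p₁] else 0)]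
  refine Fintype.sum_equiv (finTwoArrowEquiv P) _ _ fun p => ?_
  change (if x (p 0) - x (p 1) + y = 0 then Φ p else 0) = (if x (p 1) = x (p 0) + y then Φ ![p 0, p 1] else 0)
  have hp : (![p 0, p 1] : Fin 2 → P) = p := by funext i; fin_cases i <;> rfl
  rw [hp]
  have hiff : x (p 0) - x (p 1) + y = 0 ↔ x (p 1) = x (p 0) + y := by
    constructor
    · intro h
      have : x (p 1) = x (p 0) + y - (x (p 0) - x (p 1) + y) + 0 := by abel
      rw [this, h]; abel
    · intro h; rw [h]; abel
  by_cases h : x (p 1) = x (p 0) + y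
  · rw [if_pos (hiff.2 h), if_pos h]
  · rw [if_neg (fun h' => h (hiff.1 h')), if_neg h]

/-- **Base-point–independent rows: `c(y) = (2N/β)·Re R_W(o, y)`.**  If the phase-weighted two-leg rows
`R(p₀,y) = Σ_{p₁ : x_{p₁} = x_{p₀} + y} e^{iω(τ_{p₀} − τ_{p₁})} W(p₀,p₁)` do not depend on `p₀` (`hrow`) and `|P| = N·L²`, then for even data
`c_{Re Σ_G((ω,·),σ)}(y) = (2N/β)·Re R(o,y)` — no volume factor left. -/
theorem torusCosCoeff_re_selfEnergy_eq_row [NeZero M] {β : ℝ} (hβ : β ≠ 0) {N : ℕ} (x : P → TorusSite 2 L) (τ : P → ℝ)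
    (hP : Fintype.card P = N * L ^ 2) (W : GrassmannAlgebra ℂ (GridLeg P)) (n : MatsubaraIdx M) (σ : Fin 2)
    (heven : ∀ k : TorusSite 2 L,
      selfEnergy L M β (ExteriorAlgebra.map (Matrix.toLin' (gridSubMatrix L M β x τ)) W) (n, -k) σ =
        selfEnergy L M β (ExteriorAlgebra.map (Matrix.toLin' (gridSubMatrix L M β x τ)) W) (n, k) σ)
    (o : P)
    (hrow : ∀ (p₀ : P) (y : TorusSite 2 L),
      (∑ p₁ : P, if x p₁ = x p₀ + y then
        Complex.exp (((matsubaraFreq β M n * (τ p₀ - τ p₁) : ℝ) : ℂ) * Complex.I) * kernel ℂ W 2 (fun i => ((![p₀, p₁] i, σ), i))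
        else 0) =
      ∑ p₁ : P, if x p₁ = x o + y then
        Complex.exp (((matsubaraFreq β M n * (τ o - τ p₁) : ℝ) : ℂ) * Complex.I) * kernel ℂ W 2 (fun i => ((![o, p₁] i, σ), i))
        else 0)
    (y : TorusSite 2 L) :
    torusCosCoeff L (fun k => (selfEnergy L M β (ExteriorAlgebra.map (Matrix.toLin' (gridSubMatrix L M β x τ)) W) (n, k) σ).re) y =
      2 * N / β * (∑ p₁ : P, if x p₁ = x o + y then
        Complex.exp (((matsubaraFreq β M n * (τ o - τ p₁) : ℝ) : ℂ) * Complex.I) * kernel ℂ W 2 (fun i => ((![o, p₁] i, σ), i))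
        else 0).re := by
  rw [torusCosCoeff_re_selfEnergy_map_gridSub_eq hβ x τ W n σ heven y]
  have hpair := sum_pair_eq_sum_row x (fun p : Fin 2 → P =>
    Complex.exp (((matsubaraFreq β M n * (τ (p 0) - τ (p 1)) : ℝ) : ℂ) * Complex.I) * kernel ℂ W 2 (fun i => ((p i, σ), i))) y
  rw [hpair]
  simp only [Matrix.cons_val_zero, Matrix.cons_val_one]
  simp_rw [hrow]
  rw [Finset.sum_const, Finset.card_univ, hP, nsmul_eq_mul,
    show ((N * L ^ 2 : ℕ) : ℂ) = (((N * L ^ 2 : ℕ) : ℝ) : ℂ) by norm_cast, Complex.re_ofReal_mul]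
  have hL : (L : ℝ) ≠ 0 := by exact_mod_cast NeZero.ne L
  have key : ∀ r : ℝ, 2 / (β * (L : ℝ) ^ 2) * (((N * L ^ 2 : ℕ) : ℝ) * r) = 2 * N / β * r := by
    intro r
    push_cast
    field_simp
  exact key _

end Rows

/-! ## §3 Two nested volumes on the common time grid: pinned difference + far tail ≤ the pinned two-leg grid defect -/

section Nested

variable {b Lc Lf M : ℕ} [NeZero Lc] [NeZero Lf]
variable {P P' : Type*} [Fintype P] [DecidableEq P] [Fintype P'] [DecidableEq P']

omit [NeZero Lc] [NeZero Lf] in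
/-- `clift 0 = 0`. -/
theorem clift_zero : Torus.proj Lf (Torus.cRep (0 : TorusSite 2 Lc)) = 0 := by
  funext i
  rw [Torus.proj_apply, Torus.cRep]
  have : Torus.cRepZ ((0 : TorusSite 2 Lc) i) = 0 := by
    show Torus.cRepZ (0 : ZMod Lc) = 0
    simp [Torus.cRepZ]
  rw [this]; simp

/-- The centred lift is injective. -/
theorem clift_injective (hL : Lf = b * Lc) :
    Function.Injective (fun xbar : TorusSite 2 Lc => Torus.proj Lf (Torus.cRep xbar)) := by
  intro u v h
  have hu := reduce_clift (d := 2) hL u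
  have hv := reduce_clift (d := 2) hL v
  rw [← hu, ← hv]
  exact congrArg (fun z : TorusSite 2 Lf => (fun i => (((z i).val : ℕ) : ZMod Lc))) h

/-- A centred lift is its own `clift ∘ red`. -/
theorem clift_reduce_clift (hL : Lf = b * Lc) (xbar : TorusSite 2 Lc) :
    Torus.proj Lf (Torus.cRep (fun i => ((((Torus.proj Lf (Torus.cRep xbar)) i).val : ℕ) : ZMod Lc))) =
      Torus.proj Lf (Torus.cRep xbar) := by
  rw [reduce_clift hL xbar]

omit [DecidableEq P] in
/-- **The fine row at a lifted offset is read on the block.**  With `x o = 0`, `x' (ι p) = clift (x p)`, `τ' (ι p) = τ p`, `ι` injective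
and every fine point with centred-lift site in the range of `ι`: the fine phase-weighted row at offset `clift ȳ` is the sum over the
COARSE points of offset `ȳ` of the fine kernel on the block. -/
theorem row_fine_clift_eq (hL : Lf = b * Lc) {β : ℝ} (x : P → TorusSite 2 Lc) (τ : P → ℝ) (x' : P' → TorusSite 2 Lf) (τ' : P' → ℝ)
    (ι : P → P') (hι : Function.Injective ι) (hιx : ∀ p, x' (ι p) = Torus.proj Lf (Torus.cRep (x p))) (hιτ : ∀ p, τ' (ι p) = τ p)
    (hblock : ∀ p' : P', Torus.proj Lf (Torus.cRep (fun i => (((x' p' i).val : ℕ) : ZMod Lc))) = x' p' → p' ∈ Set.range ι)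
    {o : P} (hxo : x o = 0) (n : MatsubaraIdx M) (g : P' → ℂ) (ybar : TorusSite 2 Lc) :
    (∑ p₁' : P', if x' p₁' = x' (ι o) + Torus.proj Lf (Torus.cRep ybar) then
        Complex.exp (((matsubaraFreq β M n * (τ' (ι o) - τ' p₁') : ℝ) : ℂ) * Complex.I) * g p₁' else 0) =
      ∑ p₁ : P, if x p₁ = x o + ybar then
        Complex.exp (((matsubaraFreq β M n * (τ o - τ p₁) : ℝ) : ℂ) * Complex.I) * g (ι p₁) else 0 := by
  classical
  have hxo' : x' (ι o) = 0 := by rw [hιx, hxo]; exact clift_zero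
  rw [hxo', hxo, zero_add, zero_add]
  -- terms outside the range vanish
  have hvan : ∀ p₁' : P', p₁' ∉ Set.range ι →
      (if x' p₁' = Torus.proj Lf (Torus.cRep ybar) then
        Complex.exp (((matsubaraFreq β M n * (τ' (ι o) - τ' p₁') : ℝ) : ℂ) * Complex.I) * g p₁' else 0) = 0 := by
    intro p₁' hp
    rw [if_neg]
    intro hx
    refine hp (hblock p₁' ?_)
    rw [hx]
    exact clift_reduce_clift hL ybar
  -- restrict to the image of ι and reindex
  rw [← Finset.sum_subset (Finset.subset_univ (Finset.univ.image ι)) (fun p₁' _ hp => hvan p₁' (by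
      intro hr; obtain ⟨p, rfl⟩ := hr; exact hp (Finset.mem_image_of_mem ι (Finset.mem_univ p))))]
  rw [Finset.sum_image (fun p _ q _ h => hι h)]
  refine Finset.sum_congr rfl fun p₁ _ => ?_
  have hiff : x' (ι p₁) = Torus.proj Lf (Torus.cRep ybar) ↔ x p₁ = ybar := by
    rw [hιx]
    exact ⟨fun h => clift_injective hL h, fun h => by rw [h]⟩
  rw [hιτ, hιτ]
  by_cases h : x p₁ = ybar
  · rw [if_pos (hiff.2 h), if_pos h]
  · rw [if_neg (fun h' => h (hiff.1 h')), if_neg h]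

omit [NeZero Lf] [Fintype P'] [DecidableEq P'] [DecidableEq P] in
/-- **The pinned part, termwise**: `Σ_{ȳ} ‖R(o,ȳ) − Σ_{p₁ : x p₁ = ȳ} phase·g'(ι p₁)‖ ≤ Σ_{p₁} ‖g p₁ − g' (ι p₁)‖` (phases have modulus one;
every coarse point has exactly one offset). -/
theorem sum_norm_row_sub_row_le {β : ℝ} (x : P → TorusSite 2 Lc) (τ : P → ℝ) {o : P} (hxo : x o = 0) (n : MatsubaraIdx M)
    (g h : P → ℂ) :
    ∑ ybar : TorusSite 2 Lc, ‖(∑ p₁ : P, if x p₁ = x o + ybar then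
        Complex.exp (((matsubaraFreq β M n * (τ o - τ p₁) : ℝ) : ℂ) * Complex.I) * g p₁ else 0) -
      (∑ p₁ : P, if x p₁ = x o + ybar then
        Complex.exp (((matsubaraFreq β M n * (τ o - τ p₁) : ℝ) : ℂ) * Complex.I) * h p₁ else 0)‖ ≤
      ∑ p₁ : P, ‖g p₁ - h p₁‖ := by
  classical
  rw [hxo]
  simp_rw [zero_add]
  have hstep : ∀ ybar : TorusSite 2 Lc, ‖(∑ p₁ : P, if x p₁ = ybar then
        Complex.exp (((matsubaraFreq β M n * (τ o - τ p₁) : ℝ) : ℂ) * Complex.I) * g p₁ else 0) -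
      (∑ p₁ : P, if x p₁ = ybar then
        Complex.exp (((matsubaraFreq β M n * (τ o - τ p₁) : ℝ) : ℂ) * Complex.I) * h p₁ else 0)‖ ≤
      ∑ p₁ : P, if x p₁ = ybar then ‖g p₁ - h p₁‖ else 0 := by
    intro ybar
    rw [← Finset.sum_sub_distrib]
    refine (norm_sum_le _ _).trans (Finset.sum_le_sum fun p₁ _ => ?_)
    split_ifs
    · rw [← mul_sub, norm_mul, Complex.norm_exp_ofReal_mul_I, one_mul]
    · rw [sub_zero, norm_zero]
  refine (Finset.sum_le_sum fun ybar _ => hstep ybar).trans (le_of_eq ?_)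
  rw [Finset.sum_comm]
  refine Finset.sum_congr rfl fun p₁ _ => ?_
  rw [Finset.sum_ite_eq Finset.univ (x p₁) (fun _ => ‖g p₁ - h p₁‖), if_pos (Finset.mem_univ _)]

omit [DecidableEq P] in
/-- **The far part**: the fine rows summed over the NON-lifted offsets are at most the fine kernel summed OUTSIDE the block. -/
theorem sum_far_norm_row_le (hL : Lf = b * Lc) {β : ℝ} (x : P → TorusSite 2 Lc) (x' : P' → TorusSite 2 Lf) (τ' : P' → ℝ) (ι : P → P')
    (hιx : ∀ p, x' (ι p) = Torus.proj Lf (Torus.cRep (x p))) {o : P} (hxo : x o = 0) (n : MatsubaraIdx M) (g : P' → ℂ) :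
    ∑ y ∈ univ.filter (fun y : TorusSite 2 Lf => Torus.proj Lf (Torus.cRep (fun i => (((y i).val : ℕ) : ZMod Lc))) ≠ y),
        ‖∑ p₁' : P', if x' p₁' = x' (ι o) + y then
          Complex.exp (((matsubaraFreq β M n * (τ' (ι o) - τ' p₁') : ℝ) : ℂ) * Complex.I) * g p₁' else 0‖ ≤
      ∑ p₁' ∈ univ.filter (fun p₁' : P' => p₁' ∉ Set.range ι), ‖g p₁'‖ := by
  classical
  have hxo' : x' (ι o) = 0 := by rw [hιx, hxo]; exact clift_zero
  simp_rw [hxo', zero_add]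
  set Far : Finset (TorusSite 2 Lf) :=
    univ.filter (fun y : TorusSite 2 Lf => Torus.proj Lf (Torus.cRep (fun i => (((y i).val : ℕ) : ZMod Lc))) ≠ y) with hFar
  -- termwise bound, then exchange the sums
  have hstep : ∀ y ∈ Far, ‖∑ p₁' : P', if x' p₁' = y then
        Complex.exp (((matsubaraFreq β M n * (τ' (ι o) - τ' p₁') : ℝ) : ℂ) * Complex.I) * g p₁' else 0‖ ≤
      ∑ p₁' : P', if x' p₁' = y then ‖g p₁'‖ else 0 := by
    intro y _
    refine (norm_sum_le _ _).trans (Finset.sum_le_sum fun p₁' _ => ?_)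
    split_ifs
    · rw [norm_mul, Complex.norm_exp_ofReal_mul_I, one_mul]
    · rw [norm_zero]
  refine (Finset.sum_le_sum hstep).trans ?_
  rw [Finset.sum_comm]
  -- each fine point contributes at most once, and only if its site is far, hence only if it is off the block
  have hpt : ∀ p₁' : P', (∑ y ∈ Far, if x' p₁' = y then ‖g p₁'‖ else 0) = if x' p₁' ∈ Far then ‖g p₁'‖ else 0 := by
    intro p₁'
    rw [Finset.sum_ite_eq Far (x' p₁') (fun _ => ‖g p₁'‖)]
  simp_rw [hpt]
  rw [← Finset.sum_filter]
  refine Finset.sum_le_sum_of_subset_of_nonneg (fun p₁' hp => ?_) fun _ _ _ => norm_nonneg _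
  rw [Finset.mem_filter] at hp ⊢
  refine ⟨Finset.mem_univ _, ?_⟩
  rintro ⟨p, rfl⟩
  have hfar := (Finset.mem_filter.1 hp.2).2
  rw [hιx] at hfar
  exact hfar (clift_reduce_clift hL (x p))

/-- **PINNED DIFFERENCE + FAR TAIL ≤ (2N/|β|) × THE PINNED TWO-LEG GRID DEFECT AT THE BLOCK CENTRE.**  Two nested volumes `Lf = b·Lc`
on the common `N`-point time grid, grid representations `G = map S W` (coarse), `G' = map S' W'` (fine) with even self-energy data and
base-point–independent phase-weighted rows; block embedding `ι` as in `row_fine_clift_eq`, base point `o` at the origin.  Then for the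
cosine coefficients `c`, `c'` of `k⃗ ↦ Re Σ((ω,k⃗),σ)`:
`Σ_{x̄} |c x̄ − c' (clift x̄)| + Σ_{y ≠ clift(red y)} |c' y| ≤ (2N/|β|)·[Σ_{p₁} ‖W(o,p₁) − W'(ι o, ι p₁)‖ + Σ_{p₁' ∉ range ι} ‖W'(ι o, p₁')‖]`. -/
theorem pinned_add_far_le_gridDefect [NeZero M] (hL : Lf = b * Lc) {β : ℝ} (hβ : β ≠ 0) {N : ℕ}
    (x : P → TorusSite 2 Lc) (τ : P → ℝ) (x' : P' → TorusSite 2 Lf) (τ' : P' → ℝ)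
    (hP : Fintype.card P = N * Lc ^ 2) (hP' : Fintype.card P' = N * Lf ^ 2)
    (ι : P → P') (hι : Function.Injective ι) (hιx : ∀ p, x' (ι p) = Torus.proj Lf (Torus.cRep (x p))) (hιτ : ∀ p, τ' (ι p) = τ p)
    (hblock : ∀ p' : P', Torus.proj Lf (Torus.cRep (fun i => (((x' p' i).val : ℕ) : ZMod Lc))) = x' p' → p' ∈ Set.range ι)
    {o : P} (hxo : x o = 0) (W : GrassmannAlgebra ℂ (GridLeg P)) (W' : GrassmannAlgebra ℂ (GridLeg P')) (n : MatsubaraIdx M) (σ : Fin 2)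
    (heven : ∀ k : TorusSite 2 Lc,
      selfEnergy Lc M β (ExteriorAlgebra.map (Matrix.toLin' (gridSubMatrix Lc M β x τ)) W) (n, -k) σ =
        selfEnergy Lc M β (ExteriorAlgebra.map (Matrix.toLin' (gridSubMatrix Lc M β x τ)) W) (n, k) σ)
    (heven' : ∀ k : TorusSite 2 Lf,
      selfEnergy Lf M β (ExteriorAlgebra.map (Matrix.toLin' (gridSubMatrix Lf M β x' τ')) W') (n, -k) σ =
        selfEnergy Lf M β (ExteriorAlgebra.map (Matrix.toLin' (gridSubMatrix Lf M β x' τ')) W') (n, k) σ)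
    (hrow : ∀ (p₀ : P) (y : TorusSite 2 Lc),
      (∑ p₁ : P, if x p₁ = x p₀ + y then
        Complex.exp (((matsubaraFreq β M n * (τ p₀ - τ p₁) : ℝ) : ℂ) * Complex.I) * kernel ℂ W 2 (fun i => ((![p₀, p₁] i, σ), i))
        else 0) =
      ∑ p₁ : P, if x p₁ = x o + y then
        Complex.exp (((matsubaraFreq β M n * (τ o - τ p₁) : ℝ) : ℂ) * Complex.I) * kernel ℂ W 2 (fun i => ((![o, p₁] i, σ), i))
        else 0)
    (hrow' : ∀ (p₀' : P') (y : TorusSite 2 Lf),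
      (∑ p₁' : P', if x' p₁' = x' p₀' + y then
        Complex.exp (((matsubaraFreq β M n * (τ' p₀' - τ' p₁') : ℝ) : ℂ) * Complex.I) * kernel ℂ W' 2 (fun i => ((![p₀', p₁'] i, σ), i))
        else 0) =
      ∑ p₁' : P', if x' p₁' = x' (ι o) + y then
        Complex.exp (((matsubaraFreq β M n * (τ' (ι o) - τ' p₁') : ℝ) : ℂ) * Complex.I) * kernel ℂ W' 2 (fun i => ((![ι o, p₁'] i, σ), i))
        else 0) :
    (∑ xbar : TorusSite 2 Lc,
        |torusCosCoeff Lc (fun k => (selfEnergy Lc M β (ExteriorAlgebra.map (Matrix.toLin' (gridSubMatrix Lc M β x τ)) W) (n, k) σ).re) xbar -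
          torusCosCoeff Lf (fun k => (selfEnergy Lf M β (ExteriorAlgebra.map (Matrix.toLin' (gridSubMatrix Lf M β x' τ')) W') (n, k) σ).re)
            (Torus.proj Lf (Torus.cRep xbar))|) +
      ∑ y ∈ univ.filter (fun y : TorusSite 2 Lf => Torus.proj Lf (Torus.cRep (fun i => (((y i).val : ℕ) : ZMod Lc))) ≠ y),
        |torusCosCoeff Lf (fun k => (selfEnergy Lf M β (ExteriorAlgebra.map (Matrix.toLin' (gridSubMatrix Lf M β x' τ')) W') (n, k) σ).re) y| ≤
      2 * N / |β| *
        ((∑ p₁ : P, ‖kernel ℂ W 2 (fun i => ((![o, p₁] i, σ), i)) - kernel ℂ W' 2 (fun i => ((![ι o, ι p₁] i, σ), i))‖) +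
          ∑ p₁' ∈ univ.filter (fun p₁' : P' => p₁' ∉ Set.range ι), ‖kernel ℂ W' 2 (fun i => ((![ι o, p₁'] i, σ), i))‖) := by
  classical
  -- the two coefficient formulas through rows at the base points `o`, `ι o`
  have hc : ∀ ybar : TorusSite 2 Lc,
      torusCosCoeff Lc (fun k => (selfEnergy Lc M β (ExteriorAlgebra.map (Matrix.toLin' (gridSubMatrix Lc M β x τ)) W) (n, k) σ).re) ybar =
        2 * N / β * (∑ p₁ : P, if x p₁ = x o + ybar then
          Complex.exp (((matsubaraFreq β M n * (τ o - τ p₁) : ℝ) : ℂ) * Complex.I) * kernel ℂ W 2 (fun i => ((![o, p₁] i, σ), i))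
          else 0).re :=
    fun ybar => torusCosCoeff_re_selfEnergy_eq_row hβ x τ hP W n σ heven o hrow ybar
  have hc' : ∀ y : TorusSite 2 Lf,
      torusCosCoeff Lf (fun k => (selfEnergy Lf M β (ExteriorAlgebra.map (Matrix.toLin' (gridSubMatrix Lf M β x' τ')) W') (n, k) σ).re) y =
        2 * N / β * (∑ p₁' : P', if x' p₁' = x' (ι o) + y then
          Complex.exp (((matsubaraFreq β M n * (τ' (ι o) - τ' p₁') : ℝ) : ℂ) * Complex.I) * kernel ℂ W' 2 (fun i => ((![ι o, p₁'] i, σ), i))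
          else 0).re :=
    fun y => torusCosCoeff_re_selfEnergy_eq_row hβ x' τ' hP' W' n σ heven' (ι o) hrow' y
  -- abbreviations for the kernels as functions of the second point
  set g : P → ℂ := fun p₁ => kernel ℂ W 2 (fun i => ((![o, p₁] i, σ), i)) with hg
  set g' : P' → ℂ := fun p₁' => kernel ℂ W' 2 (fun i => ((![ι o, p₁'] i, σ), i)) with hg'
  have hβ0 : 0 < |β| := abs_pos.2 hβ
  have hcoef : |2 * (N : ℝ) / β| = 2 * N / |β| := by
    rw [abs_div, abs_of_nonneg (by positivity : (0 : ℝ) ≤ 2 * N)]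
  -- (i) the pinned part
  have hpin : (∑ xbar : TorusSite 2 Lc,
      |torusCosCoeff Lc (fun k => (selfEnergy Lc M β (ExteriorAlgebra.map (Matrix.toLin' (gridSubMatrix Lc M β x τ)) W) (n, k) σ).re) xbar -
        torusCosCoeff Lf (fun k => (selfEnergy Lf M β (ExteriorAlgebra.map (Matrix.toLin' (gridSubMatrix Lf M β x' τ')) W') (n, k) σ).re)
          (Torus.proj Lf (Torus.cRep xbar))|) ≤
      2 * N / |β| * ∑ p₁ : P, ‖g p₁ - g' (ι p₁)‖ := by
    have hterm : ∀ xbar : TorusSite 2 Lc,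
        |torusCosCoeff Lc (fun k => (selfEnergy Lc M β (ExteriorAlgebra.map (Matrix.toLin' (gridSubMatrix Lc M β x τ)) W) (n, k) σ).re) xbar -
          torusCosCoeff Lf (fun k => (selfEnergy Lf M β (ExteriorAlgebra.map (Matrix.toLin' (gridSubMatrix Lf M β x' τ')) W') (n, k) σ).re)
            (Torus.proj Lf (Torus.cRep xbar))| ≤
        2 * N / |β| * ‖(∑ p₁ : P, if x p₁ = x o + xbar then
            Complex.exp (((matsubaraFreq β M n * (τ o - τ p₁) : ℝ) : ℂ) * Complex.I) * g p₁ else 0) -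
          (∑ p₁ : P, if x p₁ = x o + xbar then
            Complex.exp (((matsubaraFreq β M n * (τ o - τ p₁) : ℝ) : ℂ) * Complex.I) * g' (ι p₁) else 0)‖ := by
      intro xbar
      rw [hc xbar, hc' (Torus.proj Lf (Torus.cRep xbar)),
        row_fine_clift_eq hL x τ x' τ' ι hι hιx hιτ hblock hxo n g' xbar, ← mul_sub, ← Complex.sub_re, abs_mul, hcoef]
      exact mul_le_mul_of_nonneg_left (Complex.abs_re_le_norm _) (by positivity)
    refine (Finset.sum_le_sum fun xbar _ => hterm xbar).trans ?_
    rw [← Finset.mul_sum]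
    exact mul_le_mul_of_nonneg_left (sum_norm_row_sub_row_le x τ hxo n g (fun p₁ => g' (ι p₁))) (by positivity)
  -- (ii) the far part
  have hfarle : ∑ y ∈ univ.filter (fun y : TorusSite 2 Lf => Torus.proj Lf (Torus.cRep (fun i => (((y i).val : ℕ) : ZMod Lc))) ≠ y),
      |torusCosCoeff Lf (fun k => (selfEnergy Lf M β (ExteriorAlgebra.map (Matrix.toLin' (gridSubMatrix Lf M β x' τ')) W') (n, k) σ).re) y| ≤
      2 * N / |β| * ∑ p₁' ∈ univ.filter (fun p₁' : P' => p₁' ∉ Set.range ι), ‖g' p₁'‖ := by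
    have hterm : ∀ y : TorusSite 2 Lf,
        |torusCosCoeff Lf (fun k => (selfEnergy Lf M β (ExteriorAlgebra.map (Matrix.toLin' (gridSubMatrix Lf M β x' τ')) W') (n, k) σ).re) y| ≤
        2 * N / |β| * ‖∑ p₁' : P', if x' p₁' = x' (ι o) + y then
            Complex.exp (((matsubaraFreq β M n * (τ' (ι o) - τ' p₁') : ℝ) : ℂ) * Complex.I) * g' p₁' else 0‖ := by
      intro y
      rw [hc' y, abs_mul, hcoef]
      exact mul_le_mul_of_nonneg_left (Complex.abs_re_le_norm _) (by positivity)
    refine (Finset.sum_le_sum fun y _ => hterm y).trans ?_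
    rw [← Finset.mul_sum]
    exact mul_le_mul_of_nonneg_left (sum_far_norm_row_le hL x x' τ' ι hιx hxo n g') (by positivity)
  rw [mul_add]
  exact add_le_add hpin hfarle

end Nested

end Summit.HubbardSuperconductivity.HubbardSuperconductivity.Theorems.TwoVolumeDefect

end
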